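import Mathlib
import Summits.Ventures.HodgeRepro.Tier4.Target
import Summits.Ventures.HodgeRepro.Tier4.Common.TargetData
import Summits.Ventures.HodgeRepro.Tier4.Common.TargetBall
import Summits.Ventures.HodgeRepro.Tier4.Common.TargetCalculus
import Summits.Ventures.HodgeRepro.Tier4.Common.AutForms
import Summits.Ventures.HodgeRepro.Tier4.Common.HeckeOnForms
import Summits.Ventures.HodgeRepro.Tier4.Common.HeckeInvariance
import Summits.Ventures.HodgeRepro.Tier4.Common.BallBounds
import Summits.Ventures.HodgeRepro.Tier4.Common.FixedSetNull
import Summits.Ventures.HodgeRepro.Tier4.Common.FundamentalDomain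

/-!
# Tier4/Common/ProperDiscontinuity — «finitely many `γ` meet a compact», the ball action seen through its maps

Blind re-derivation cell `pub-hodge-repro`, Tier 4 «prove the step» (README §9–§10), seat t4-L4-p1 (prover, LINE L4,
gen 0; support for L4.0′ `pair11_descends` (split with t4-L4-p2, lead M0 S12394) and for every line that needs proper
discontinuity — t4-plan-1 S12182 named «finitely many γ meet a compact»).  Tree path
`lean/Summits/Ventures/HodgeRepro/Tier4/Common/ProperDiscontinuity.lean`.  No literature input.

WHAT IS PROVED.
* Proper discontinuity, UNCONDITIONAL (from `Tier4/Common/FundamentalDomain.lean`): `finite_meets_nsqBall` — for a level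
  `Γ′ ⊆ Γ` and `0 ≤ t < 1`, finitely many `γ ∈ Γ′` move a point of `{nsq ≤ t²}` into `{nsq ≤ t²}`; `finite_meets_compact`
  for every compact `K ⊆ 𝔹²`; `finite_orbit_inter_compact`: every orbit meets a compact `K ⊆ 𝔹²` in finitely many points.
* `actM_eq_of_eqOn_ball`: two elements of `U(2,1)` with the same action on the ball have the same action on all of `ℂ²`
  (`scalar_of_fixes_ball`: a matrix of `U(2,1)` fixing the ball pointwise is scalar — five evaluation points).
* The maps of `ballActions τ₀ C Γ′` through representatives (`rep`, `act_rep`), two maps agreeing on the ball are equal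
  (`ballActions_ext`), and the shift `φ ↦ φ ∘ act γ₀` is a bijection of `ballActions` (`shiftEquiv`), whence
  `tsum_shift`: `Σ_φ g (φ (act γ₀ z)) = Σ_φ g (φ z)` on the ball.

Consumed by `Tier4/Common/PartitionFunction.lean`.  HC_CM is NOT proved by anyone in this repository.
-/

set_option autoImplicit false

noncomputable section

open Matrix Metric NumberField MeasureTheory Filter Topology
open scoped ComplexConjugate ComplexOrder

namespace Summit.Ventures.HodgeRepro.Tier4

/-! ## A. Proper discontinuity -/

section ProperDiscontinuity

variable {F E : Type} [Field F] [NumberField F] [IsGalois ℚ F] [IsCMField F]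
  [Field E] [NumberField E] [IsGalois ℚ E] [IsCMField E] (d : TargetData F E)

/-- **Proper discontinuity on the balls `{nsq ≤ t²}`**: finitely many `γ ∈ Γ′` move a point of `{nsq ≤ t²}` into
`{nsq ≤ t²}`. -/
theorem finite_meets_nsqBall {Γ' : Set (Matrix (Fin 3) (Fin 3) E)} (hΓ' : Γ' ⊆ d.Γ) {t : ℝ} (ht0 : 0 ≤ t) (ht1 : t < 1) :
    {γ | γ ∈ Γ' ∧ ∃ z, nsq z ≤ t ^ 2 ∧ nsq (d.act γ z) ≤ t ^ 2}.Finite := by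
  refine (finite_bounded_part d (1 / ((1 - t) * Real.sqrt (1 - t ^ 2)))).subset ?_
  rintro γ ⟨hγ, z, hz, hw⟩
  have hzb : z ∈ ball := by
    show nsq z < 1
    nlinarith
  refine ⟨hΓ' hγ, fun i j => ?_⟩
  exact norm_entry_le_of_mem_ball (d.toBallMat_mem_U21 (hΓ' hγ)) hzb ht0 ht1 hz hw i j

/-- A compact subset of the open ball lies in `{nsq ≤ t²}` for some `t < 1`. -/
theorem exists_nsq_le_of_isCompact {K : Set (Fin 2 → ℂ)} (hK : IsCompact K) (hKb : K ⊆ ball) :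
    ∃ t : ℝ, 0 ≤ t ∧ t < 1 ∧ ∀ z ∈ K, nsq z ≤ t ^ 2 := by
  rcases K.eq_empty_or_nonempty with hKe | hKne
  · exact ⟨0, le_rfl, zero_lt_one, fun z hz => by simp [hKe] at hz⟩
  obtain ⟨z₀, hz₀, hmax⟩ := hK.exists_isMaxOn hKne continuous_nsq.continuousOn
  refine ⟨Real.sqrt (nsq z₀), Real.sqrt_nonneg _, ?_, fun z hz => ?_⟩
  · rw [Real.sqrt_lt' one_pos, one_pow]
    exact hKb hz₀
  · rw [Real.sq_sqrt (nsq_nonneg z₀)]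
    exact hmax hz

/-- **Proper discontinuity**: for a compact `K ⊆ 𝔹²`, finitely many `γ ∈ Γ′` satisfy `γ K ∩ K ≠ ∅`. -/
theorem finite_meets_compact {Γ' : Set (Matrix (Fin 3) (Fin 3) E)} (hΓ' : Γ' ⊆ d.Γ) {K : Set (Fin 2 → ℂ)}
    (hK : IsCompact K) (hKb : K ⊆ ball) : {γ | γ ∈ Γ' ∧ ∃ z ∈ K, d.act γ z ∈ K}.Finite := by
  obtain ⟨t, ht0, ht1, hKt⟩ := exists_nsq_le_of_isCompact hK hKb
  refine (finite_meets_nsqBall d hΓ' ht0 ht1).subset ?_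
  rintro γ ⟨hγ, z, hz, hw⟩
  exact ⟨hγ, z, hKt z hz, hKt _ hw⟩

/-- **Orbits are discrete in the ball**: an orbit meets a compact `K ⊆ 𝔹²` in finitely many points. -/
theorem finite_orbit_inter_compact {Γ' : Set (Matrix (Fin 3) (Fin 3) E)} (hΓ' : Γ' ⊆ d.Γ) {K : Set (Fin 2 → ℂ)}
    (hK : IsCompact K) (hKb : K ⊆ ball) {z : Fin 2 → ℂ} (hz : z ∈ ball) :
    {w | w ∈ K ∧ ∃ γ ∈ Γ', d.act γ z = w}.Finite := by
  obtain ⟨t, ht0, ht1, hKt⟩ := exists_nsq_le_of_isCompact hK hKb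
  set s : ℝ := max t (Real.sqrt (nsq z)) with hs
  have hs0 : 0 ≤ s := le_max_of_le_left ht0
  have hs1 : s < 1 := by
    rw [hs, max_lt_iff]
    refine ⟨ht1, ?_⟩
    rw [Real.sqrt_lt' one_pos, one_pow]
    exact hz
  have hzs : nsq z ≤ s ^ 2 := by
    have h1 : Real.sqrt (nsq z) ≤ s := le_max_right _ _
    have h2 := Real.sq_sqrt (nsq_nonneg z)
    nlinarith [Real.sqrt_nonneg (nsq z)]
  have hts : t ^ 2 ≤ s ^ 2 := by
    have := le_max_left t (Real.sqrt (nsq z))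
    nlinarith
  have hfin := finite_meets_nsqBall d hΓ' hs0 hs1
  refine (hfin.image fun γ => d.act γ z).subset ?_
  rintro w ⟨hwK, γ, hγ, rfl⟩
  exact ⟨γ, ⟨hγ, z, hzs, (hKt _ hwK).trans hts⟩, rfl⟩

end ProperDiscontinuity

/-! ## B. Two elements of `U(2,1)` with the same action on the ball act the same everywhere -/

section Scalar

variable {N M₁ M₂ : Matrix (Fin 3) (Fin 3) ℂ}

/-- The eigenvector relation at a fixed point of the ball. -/
theorem mulVec_lift3_eq_smul_of_fixed (hN : Nᴴ * J * N = J) {x : Fin 2 → ℂ} (hx : x ∈ ball) (hfix : actM N x = x) :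
    N *ᵥ lift3 x = (N *ᵥ lift3 x) 2 • lift3 x := by
  have h2 := mulVec_lift3_two_ne_zero hN hx
  set c : ℂ := (N *ᵥ lift3 x) 2 with hc
  have hl := lift3_actM h2
  rw [hfix] at hl
  conv_rhs => rw [hl]
  rw [smul_smul, mul_inv_cancel₀ h2, one_smul]

/-- **A matrix of `U(2,1)` fixing the ball pointwise is scalar**: `N = N 2 2 • 1`. -/
theorem scalar_of_fixes_ball (hN : Nᴴ * J * N = J) (h : ∀ z ∈ ball, actM N z = z) :
    N = N 2 2 • (1 : Matrix (Fin 3) (Fin 3) ℂ) := by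
  have mem : ∀ a b : ℝ, a ^ 2 + b ^ 2 < 1 → (![(a : ℂ), (b : ℂ)] : Fin 2 → ℂ) ∈ ball := by
    intro a b hab
    show nsq _ < 1
    simp [nsq, Complex.norm_real]
    nlinarith [abs_nonneg a, abs_nonneg b, sq_abs a, sq_abs b]
  have key : ∀ a b : ℝ, a ^ 2 + b ^ 2 < 1 → ∀ i : Fin 3,
      N i 0 * a + N i 1 * b + N i 2 = (N 2 0 * a + N 2 1 * b + N 2 2) * (lift3 (![(a : ℂ), (b : ℂ)]) i) := by
    intro a b hab i
    have := congrFun (mulVec_lift3_eq_smul_of_fixed hN (mem a b hab) (h _ (mem a b hab))) i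
    rw [Pi.smul_apply, smul_eq_mul, mulVec_lift3_apply, mulVec_lift3_apply] at this
    simpa using this
  have e0 := key 0 0 (by norm_num)
  have e1 := key (1 / 2) 0 (by norm_num)
  have e2 := key (1 / 4) 0 (by norm_num)
  have e3 := key 0 (1 / 2) (by norm_num)
  have e4 := key 0 (1 / 4) (by norm_num)
  have e00 := e0 0; have e01 := e0 1; have e02 := e0 2
  have e10 := e1 0; have e11 := e1 1; have e12 := e1 2
  have e20 := e2 0; have e21 := e2 1; have e22 := e2 2
  have e30 := e3 0; have e31 := e3 1; have e32 := e3 2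
  have e40 := e4 0; have e41 := e4 1; have e42 := e4 2
  simp [lift3] at e00 e01 e10 e11 e20 e30 e31 e40 e41
  have h02 : N 0 2 = 0 := e00
  have h12 : N 1 2 = 0 := e01
  have h10 : N 1 0 = 0 := by linear_combination (2 : ℂ) * e11 - (2 : ℂ) * h12
  have h01 : N 0 1 = 0 := by linear_combination (2 : ℂ) * e30 - (2 : ℂ) * h02
  have h20 : N 2 0 = 0 := by linear_combination (-8 : ℂ) * e10 + (16 : ℂ) * e20 - (8 : ℂ) * h02
  have h00 : N 0 0 = N 2 2 := by linear_combination (2 : ℂ) * e10 - (2 : ℂ) * h02 + (1 / 2 : ℂ) * h20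
  have h21 : N 2 1 = 0 := by linear_combination (-8 : ℂ) * e31 + (16 : ℂ) * e41 - (8 : ℂ) * h12
  have h11 : N 1 1 = N 2 2 := by linear_combination (2 : ℂ) * e31 - (2 : ℂ) * h12 + (1 / 2 : ℂ) * h21
  ext i j
  fin_cases i <;> fin_cases j <;> simp [h00, h01, h02, h10, h11, h12, h20, h21]


/-- `U(2,1)` is closed under products. -/
theorem U21_mul {A B : Matrix (Fin 3) (Fin 3) ℂ} (hA : Aᴴ * J * A = J) (hB : Bᴴ * J * B = J) :
    (A * B)ᴴ * J * (A * B) = J := by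
  rw [Matrix.conjTranspose_mul]
  calc Bᴴ * Aᴴ * J * (A * B) = Bᴴ * (Aᴴ * J * A) * B := by simp only [Matrix.mul_assoc]
    _ = J := by rw [hA, hB]

/-- `Jᴴ = J`. -/
theorem J_conjTranspose : Jᴴ = J := by
  ext i j
  fin_cases i <;> fin_cases j <;> simp [J]

/-- **Two elements of `U(2,1)` with the same action on the ball act the same on all of `ℂ²`.** -/
theorem actM_eq_of_eqOn_ball (h₁ : M₁ᴴ * J * M₁ = J) (h₂ : M₂ᴴ * J * M₂ = J)
    (h : ∀ z ∈ ball, actM M₁ z = actM M₂ z) : actM M₁ = actM M₂ := by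
  set P : Matrix (Fin 3) (Fin 3) ℂ := J * M₂ᴴ * J with hP
  have hPM : P * M₂ = 1 := by
    calc P * M₂ = J * (M₂ᴴ * J * M₂) := by simp only [hP, Matrix.mul_assoc]
      _ = 1 := by rw [h₂, J_mul_J]
  have hMP : M₂ * P = 1 := mul_eq_one_comm.1 hPM
  have hPU : Pᴴ * J * P = J := by
    have hPH : Pᴴ = J * M₂ * J := by
      rw [hP, Matrix.conjTranspose_mul, Matrix.conjTranspose_mul, J_conjTranspose, Matrix.conjTranspose_conjTranspose,
        Matrix.mul_assoc]
    rw [hPH, hP]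
    calc J * M₂ * J * J * (J * M₂ᴴ * J) = J * (M₂ * (J * J) * J * M₂ᴴ) * J := by simp only [Matrix.mul_assoc]
      _ = J * (M₂ * J * M₂ᴴ) * J := by rw [J_mul_J, Matrix.mul_one]
      _ = J := by rw [mul_J_conjTranspose_of_U21 h₂, J_mul_J, Matrix.one_mul]
  have hNU : (P * M₁)ᴴ * J * (P * M₁) = J := U21_mul hPU h₁
  have hfix : ∀ z ∈ ball, actM (P * M₁) z = z := fun z hz => by
    rw [actM_mul h₁ hz, h z hz, ← actM_mul h₂ hz, hPM, actM_one']
  have hscal := scalar_of_fixes_ball hNU hfix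
  have hc0 : (P * M₁) 2 2 ≠ 0 := by
    have h1 := one_le_norm_two_two_of_U21 hNU
    intro h0
    rw [h0, norm_zero] at h1
    linarith
  have hM₁ : M₁ = (P * M₁) 2 2 • M₂ := by
    calc M₁ = (M₂ * P) * M₁ := by rw [hMP, Matrix.one_mul]
      _ = M₂ * (P * M₁) := by rw [Matrix.mul_assoc]
      _ = M₂ * ((P * M₁) 2 2 • (1 : Matrix (Fin 3) (Fin 3) ℂ)) := by rw [← hscal]
      _ = (P * M₁) 2 2 • M₂ := by rw [Matrix.mul_smul, Matrix.mul_one]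
  rw [hM₁, actM_smul hc0]

end Scalar

/-! ## C. The shift `φ ↦ φ ∘ act γ₀` is a bijection of `ballActions` -/

section Shift

variable {F E : Type} [Field F] [NumberField F] [IsGalois ℚ F] [IsCMField F]
  [Field E] [NumberField E] [IsGalois ℚ E] [IsCMField E] (d : TargetData F E)

/-- A representative in `Γ′` of a map of `ballActions`. -/
def rep {Γ' : Set (Matrix (Fin 3) (Fin 3) E)} (φ : ballActions d.τ₀ d.C Γ') : Matrix (Fin 3) (Fin 3) E :=
  Classical.choose φ.2

/-- The representative lies in `Γ′`. -/
theorem rep_mem {Γ' : Set (Matrix (Fin 3) (Fin 3) E)} (φ : ballActions d.τ₀ d.C Γ') : rep d φ ∈ Γ' :=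
  (Classical.choose_spec φ.2).1

/-- The representative acts as the map. -/
theorem act_rep {Γ' : Set (Matrix (Fin 3) (Fin 3) E)} (φ : ballActions d.τ₀ d.C Γ') : d.act (rep d φ) = φ.1 :=
  (Classical.choose_spec φ.2).2

/-- The ball matrix of a map of `ballActions` (for a level) lies in `U(2,1)`. -/
theorem toBallMat_rep_U21 {Γ' : Set (Matrix (Fin 3) (Fin 3) E)} (hΓ' : Γ' ⊆ d.Γ) (φ : ballActions d.τ₀ d.C Γ') :
    (toBallMat d.τ₀ d.C (rep d φ))ᴴ * J * toBallMat d.τ₀ d.C (rep d φ) = J :=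
  d.toBallMat_mem_U21 (hΓ' (rep_mem d φ))

/-- The maps of `ballActions` send the ball to the ball (for a level). -/
theorem apply_mem_ball {Γ' : Set (Matrix (Fin 3) (Fin 3) E)} (hΓ' : Γ' ⊆ d.Γ) (φ : ballActions d.τ₀ d.C Γ')
    {z : Fin 2 → ℂ} (hz : z ∈ ball) : φ.1 z ∈ ball := by
  rw [← act_rep d φ]
  exact d.act_mem_ball (hΓ' (rep_mem d φ)) hz

/-- The shift `φ ↦ φ ∘ act γ₀` on `ballActions`, through representatives. -/
def shift {Γ' : Set (Matrix (Fin 3) (Fin 3) E)} (hΓ' : d.IsLevel Γ') {γ₀ : Matrix (Fin 3) (Fin 3) E} (hγ₀ : γ₀ ∈ Γ')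
    (φ : ballActions d.τ₀ d.C Γ') : ballActions d.τ₀ d.C Γ' :=
  ⟨d.act (rep d φ * γ₀), ⟨rep d φ * γ₀, (show IsCongruenceSubgroup (conjE E) d.H Γ' from hΓ'.1).mul_mem (rep_mem d φ) hγ₀, rfl⟩⟩

/-- On the ball, `shift γ₀ φ = φ ∘ act γ₀`. -/
theorem shift_apply {Γ' : Set (Matrix (Fin 3) (Fin 3) E)} (hΓ' : d.IsLevel Γ') {γ₀ : Matrix (Fin 3) (Fin 3) E}
    (hγ₀ : γ₀ ∈ Γ') (φ : ballActions d.τ₀ d.C Γ') {z : Fin 2 → ℂ} (hz : z ∈ ball) :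
    (shift d hΓ' hγ₀ φ).1 z = φ.1 (d.act γ₀ z) := by
  show d.act (rep d φ * γ₀) z = φ.1 (d.act γ₀ z)
  rw [d.act_mul (d.isUnitaryOf_of_mem (hΓ'.2 hγ₀)) hz, act_rep]

/-- Two maps of `ballActions` that agree on the ball are equal. -/
theorem ballActions_ext {Γ' : Set (Matrix (Fin 3) (Fin 3) E)} (hΓ' : d.IsLevel Γ') {φ ψ : ballActions d.τ₀ d.C Γ'}
    (h : ∀ z ∈ ball, φ.1 z = ψ.1 z) : φ = ψ := by
  apply Subtype.ext
  rw [← act_rep d φ, ← act_rep d ψ]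
  unfold TargetData.act
  refine actM_eq_of_eqOn_ball (toBallMat_rep_U21 d hΓ'.2 φ) (toBallMat_rep_U21 d hΓ'.2 ψ) fun z hz => ?_
  have := h z hz
  rwa [← act_rep d φ, ← act_rep d ψ] at this

/-- The shift by `γ₀` and the shift by its inverse are mutually inverse: `ballActions ≃ ballActions`. -/
def shiftEquiv {Γ' : Set (Matrix (Fin 3) (Fin 3) E)} (hΓ' : d.IsLevel Γ') {γ₀ γ₀' : Matrix (Fin 3) (Fin 3) E}
    (hγ₀ : γ₀ ∈ Γ') (hγ₀' : γ₀' ∈ Γ') (h1 : γ₀ * γ₀' = 1) (h2 : γ₀' * γ₀ = 1) :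
    ballActions d.τ₀ d.C Γ' ≃ ballActions d.τ₀ d.C Γ' where
  toFun := shift d hΓ' hγ₀
  invFun := shift d hΓ' hγ₀'
  left_inv φ := by
    refine ballActions_ext d hΓ' fun z hz => ?_
    rw [shift_apply d hΓ' hγ₀' _ hz, shift_apply d hΓ' hγ₀ _ (d.act_mem_ball (hΓ'.2 hγ₀') hz),
      ← d.act_mul (d.isUnitaryOf_of_mem (hΓ'.2 hγ₀')) hz, h1, act_one]
  right_inv φ := by
    refine ballActions_ext d hΓ' fun z hz => ?_
    rw [shift_apply d hΓ' hγ₀ _ hz, shift_apply d hΓ' hγ₀' _ (d.act_mem_ball (hΓ'.2 hγ₀) hz),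
      ← d.act_mul (d.isUnitaryOf_of_mem (hΓ'.2 hγ₀)) hz, h2, act_one]

/-- **Invariance of sums over `ballActions`**: `Σ_φ g (φ (act γ₀ z)) = Σ_φ g (φ z)` for `z` in the ball. -/
theorem tsum_shift {Γ' : Set (Matrix (Fin 3) (Fin 3) E)} (hΓ' : d.IsLevel Γ') {γ₀ : Matrix (Fin 3) (Fin 3) E}
    (hγ₀ : γ₀ ∈ Γ') (g : (Fin 2 → ℂ) → ℝ) {z : Fin 2 → ℂ} (hz : z ∈ ball) :
    ∑' φ : ballActions d.τ₀ d.C Γ', g (φ.1 (d.act γ₀ z)) = ∑' φ : ballActions d.τ₀ d.C Γ', g (φ.1 z) := by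
  have hcong : IsCongruenceSubgroup (conjE E) d.H Γ' := hΓ'.1
  obtain ⟨γ₀', hγ₀', h1, h2⟩ := hcong.exists_inv hγ₀
  have := Equiv.tsum_eq (shiftEquiv d hΓ' hγ₀ hγ₀' h1 h2) (fun φ : ballActions d.τ₀ d.C Γ' => g (φ.1 z))
  rw [← this]
  refine tsum_congr fun φ => ?_
  show g (φ.1 (d.act γ₀ z)) = g ((shift d hΓ' hγ₀ φ).1 z)
  rw [shift_apply d hΓ' hγ₀ φ hz]

end Shift

end Summit.Ventures.HodgeRepro.Tier4

end

#print axioms Summit.Ventures.HodgeRepro.Tier4.finite_meets_compact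
#print axioms Summit.Ventures.HodgeRepro.Tier4.actM_eq_of_eqOn_ball
#print axioms Summit.Ventures.HodgeRepro.Tier4.tsum_shift
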